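import Summits.AnomalousDissipation.AnomalousDissipation.Theorems.SolenoidalFractalHomogenisationLagrangianStepVmodFlatPointwise
import Summits.AnomalousDissipation.AnomalousDissipation.Theorems.SolenoidalFractalHomogenisationLagrangianStepVmodTextsEH
import HarnessLib

/-!
# K1L_D (stmt-AnomalousDissipation-27980): (V_mod) FLAT STAGE — the (sf)/(fs)/(ff) block texts WITH the (V) + W7 binders («EVH», RULING D27-12)
# and the pointwise flat assembly (prover ad-k1loc-p3 g9, tenure RULINGS D27-11 (1) / D27-12; `--supports 27980 --as helper`)

Finding F-k3l9-1 (prover ad-k3l-bookkeeping-p1 g9, 08:08Z) / certifier 3-probe (planner ad-ideate-p5 g14, table `Lines/onelevel-ss-regimes.md` v3 §4):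
the landed block texts `Bsf_textE`/`Bfs_textE`/`Bff_textE` (p706403: no (V), no W7 binder) are NOT derivable for small ν — on coarse classes the
regenerated slow part decays only by ITERATED (V), on high classes only W7 (`HighLabelDecayW`) gives ν-uniform decay.  RULING D27-12: all four
block texts carry the binder list of `Bss_textEH` (lead-k1l-onelevel-p1 g6, `…VmodTextsEH` p708799).  This file types
* §1 `Bsf_textEVH e`, `Bfs_textEVH e`, `Bff_textEVH e` := the E-texts with `(C : ℝ)`, `0 ≤ C →`, `SlowVectorClauseF W M hM c Φ lo hi Λ β σ C ν₀ K →`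
  and the W7 line `(∀ Kb : ℝ, 1 ≤ Kb → ∃ CK : ℝ, 1 ≤ CK ∧ ∃ cK > (0:ℝ), ∃ νh > (0:ℝ), HighLabelDecayW W M hM lo hi Λ β νh Kb CK cK) →` inserted
  VERBATIM (k3l g9's (a), byte-level); conclusions unchanged;
* §2 `lossFlatW_of_blockBounds_at` — prover ad-sawtooth-k1loc-p1 g14's assembly `lossFlatW_of_blocksE` (p706403) stated ONCE at a fixed parameter
  tuple and numeric exponent `σ'` ((F0) + four `BlockBound`s ⇒ `SlowVectorClauseLossFlatW … σ' (C₁+C₂+C₃+C₄)`; body verbatim up to `e σ ↦ σ'`),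
  companion of `…VmodFlatPointwise` (p708585) — so that no assembly proof is copied per binder;
* §3 `lossFlatW_of_blocksEVH e : CoarseSupp_text → Bss_textEH e → Bsf_textEVH e → Bfs_textEVH e → Bff_textEVH e → lossFlatW_of_V_textEH e`
  (k3l g9's (b)) and the bridges `bsfEVH_of_bsfE`, `bfsEVH_of_bfsE`, `bffEVH_of_bffE`, `bssEH_of_bssE`, `ssModeEH_of_ssModeE`,
  `lossFlatWEH_of_lossFlatWE` (E ⇒ EVH/EH, binders ignored; k3l g9's (c)), keeping the E-route a special case.
Consumers: block provers target `B??_textEVH e` ((ff) k3l g9, (sf)/(fs) later, (ss) via `SSMode_textEH`); `lossFlatW_of_V_textEH` feeds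
`Z7Glue.cellInputs_BIL_ofEH` (p708182).  `sorry`-free; NOT a proof of any block, of `stub_Vmod_of_VRH`, of K1L_D or AD; rung F-D1.A0.
-/

set_option linter.dupNamespace false

noncomputable section

namespace Summit.AnomalousDissipation.AnomalousDissipation.Theorems.SolenoidalFractalHomogenisation.LagrangianStep.VmodFlat

open Literature.Analysis Literature.Analysis.FluidPDE Literature.Analysis.FunctionSpaces
open MeasureTheory Set Filter UnitAddTorus
open scoped ENNReal NNReal InnerProductSpace
open Summit.AnomalousDissipation.AnomalousDissipation.Theorems.SolenoidalFractalHomogenisation.LagrangianStep.CellClauseMod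
open Summit.AnomalousDissipation.AnomalousDissipation.Theorems.SolenoidalFractalHomogenisation.LagrangianStep.LossCurrency
open Summit.AnomalousDissipation.AnomalousDissipation.Theorems.SolenoidalFractalHomogenisation.RealisedQuasiStaticCellLaw

/-! ## §1 The (sf)/(fs)/(ff) block texts with the binder list of `Bss_textEH` (RULING D27-12; the four (ss)-chain EH texts
`SSMode_textEH`/`BssNZ_textEH`/`Bss_textEH`/`lossFlatW_of_V_textEH` are lead-k1l-onelevel-p1 g6's `…VmodTextsEH`, p708799, imported) -/

/-- **(sf)EVH** — `Bsf_textE e` (p706403) with the binder list of `Bss_textEH` (RULING D27-12 on F-k3l9-1: `(C : ℝ)`, `0 ≤ C →`, the (V) clause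
and the W7 family; conclusion unchanged).  Per the certifier's table §4 (memo v3 da2388107b1b) the coarse classes consume (V) (iterated, T-I) and
the high classes consume W7; a prover who needs neither simply ignores them. -/
def Bsf_textEVH (e : ℝ → ℝ) : Prop := ∀ k (W : LatticeShear.LatticeWord k) (M : ℝ) (hM : 0 < M) (c : ℝ), 0 < c →
  ∀ (Φ : ℝ → Torus.Visc4 (Fin 3) → Torus.Visc4 (Fin 3)) (lo hi Λ β σ C ν₀ K : ℝ),
    0 < lo → lo ≤ 1 → 1 ≤ hi → 1 < Λ → 0 ≤ β → 0 < σ → 0 ≤ C → 0 < ν₀ → ν₀ ≤ 1 → 0 < K →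
    SlowVectorClauseF W M hM c Φ lo hi Λ β σ C ν₀ K →
    (∀ Kb : ℝ, 1 ≤ Kb → ∃ CK : ℝ, 1 ≤ CK ∧ ∃ cK > (0:ℝ), ∃ νh > (0:ℝ), HighLabelDecayW W M hM lo hi Λ β νh Kb CK cK) →
    ∃ C₂ : ℝ, 0 ≤ C₂ ∧ BlockBound W M hM c Φ lo hi Λ β (e σ) C₂ ν₀ K IsSlow IsFast

/-- **(fs)EVH** — `Bfs_textE e` (p706403) with the binder list of `Bss_textEH` (D27-12). -/
def Bfs_textEVH (e : ℝ → ℝ) : Prop := ∀ k (W : LatticeShear.LatticeWord k) (M : ℝ) (hM : 0 < M) (c : ℝ), 0 < c →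
  ∀ (Φ : ℝ → Torus.Visc4 (Fin 3) → Torus.Visc4 (Fin 3)) (lo hi Λ β σ C ν₀ K : ℝ),
    0 < lo → lo ≤ 1 → 1 ≤ hi → 1 < Λ → 0 ≤ β → 0 < σ → 0 ≤ C → 0 < ν₀ → ν₀ ≤ 1 → 0 < K →
    SlowVectorClauseF W M hM c Φ lo hi Λ β σ C ν₀ K →
    (∀ Kb : ℝ, 1 ≤ Kb → ∃ CK : ℝ, 1 ≤ CK ∧ ∃ cK > (0:ℝ), ∃ νh > (0:ℝ), HighLabelDecayW W M hM lo hi Λ β νh Kb CK cK) →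
    ∃ C₃ : ℝ, 0 ≤ C₃ ∧ BlockBound W M hM c Φ lo hi Λ β (e σ) C₃ ν₀ K IsFast IsSlow

/-- **(ff)EVH** — `Bff_textE e` (p706403) with the binder list of `Bss_textEH` (D27-12). -/
def Bff_textEVH (e : ℝ → ℝ) : Prop := ∀ k (W : LatticeShear.LatticeWord k) (M : ℝ) (hM : 0 < M) (c : ℝ), 0 < c →
  ∀ (Φ : ℝ → Torus.Visc4 (Fin 3) → Torus.Visc4 (Fin 3)) (lo hi Λ β σ C ν₀ K : ℝ),
    0 < lo → lo ≤ 1 → 1 ≤ hi → 1 < Λ → 0 ≤ β → 0 < σ → 0 ≤ C → 0 < ν₀ → ν₀ ≤ 1 → 0 < K →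
    SlowVectorClauseF W M hM c Φ lo hi Λ β σ C ν₀ K →
    (∀ Kb : ℝ, 1 ≤ Kb → ∃ CK : ℝ, 1 ≤ CK ∧ ∃ cK > (0:ℝ), ∃ νh > (0:ℝ), HighLabelDecayW W M hM lo hi Λ β νh Kb CK cK) →
    ∃ C₄ : ℝ, 0 ≤ C₄ ∧ BlockBound W M hM c Φ lo hi Λ β (e σ) C₄ ν₀ K IsFast IsFast

/-! ## §2 The flat assembly, pointwise (body of `lossFlatW_of_blocksE`, p706403, at a fixed tuple) -/

set_option maxHeartbeats 800000 in
/-- **Pointwise flat assembly** (the body of `lossFlatW_of_blocksE`, p706403, at a fixed tuple): the four block bounds at output exponent `σ'`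
with constants `C₁ … C₄ ≥ 0` and (F0) give the flat clause at exponent `σ'` with `Cm = C₁ + C₂ + C₃ + C₄`. -/
theorem lossFlatW_of_blockBounds_at (hF0 : CoarseSupp_text) {k : ℕ} (W : LatticeShear.LatticeWord k) (M : ℝ) (hM : 0 < M) {c : ℝ} (hc : 0 < c)
    (Φ : ℝ → Torus.Visc4 (Fin 3) → Torus.Visc4 (Fin 3)) {lo hi Λ β σ' C₁ C₂ C₃ C₄ ν₀ K : ℝ} (hlo : 0 < lo) (hK : 0 < K)
    (hC₁ : 0 ≤ C₁) (hC₂ : 0 ≤ C₂) (hC₃ : 0 ≤ C₃) (hC₄ : 0 ≤ C₄)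
    (B₁ : BlockBound W M hM c Φ lo hi Λ β σ' C₁ ν₀ K IsSlow IsSlow) (B₂ : BlockBound W M hM c Φ lo hi Λ β σ' C₂ ν₀ K IsSlow IsFast)
    (B₃ : BlockBound W M hM c Φ lo hi Λ β σ' C₃ ν₀ K IsFast IsSlow) (B₄ : BlockBound W M hM c Φ lo hi Λ β σ' C₄ ν₀ K IsFast IsFast) :
    SlowVectorClauseLossFlatW W M hM c Φ lo hi Λ β σ' (C₁ + C₂ + C₃ + C₄) ν₀ K := by
  intro ν hν n hn 𝔸 hodd hwin hΦo hΦw Tw hTw U T hU hT s t hs hst htT x ζ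
  -- the split at the frequency ball `freqBall (n/4)`
  set A : Set (Fin 3 → ℤ) := ↑(Torus.freqBall (d := Fin 3) (n / 4)) with hA
  have hAsym : ∀ k', k' ∈ A ↔ -k' ∈ A := fun k' => by
    rw [hA, Finset.mem_coe, Finset.mem_coe, Torus.neg_mem_freqBall]
  obtain ⟨P, hP⟩ := exists_labelProj A hAsym
  have hPoff : ∀ (y : V2) (k' : Fin 3 → ℤ), k' ∉ Torus.freqBall (d := Fin 3) (n / 4) → fc (P y) k' = 0 := by
    intro y k' hk'
    have h := hP y k'
    rw [if_neg (by rwa [hA, Finset.mem_coe] : k' ∉ A)] at h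
    exact h
  have hPon : ∀ (y : V2) (k' : Fin 3 → ℤ), k' ∈ Torus.freqBall (d := Fin 3) (n / 4) → fc (P y) k' = fc y k' := by
    intro y k' hk'
    have h := hP y k'
    rw [if_pos (by rwa [hA, Finset.mem_coe] : k' ∈ A)] at h
    exact h
  set xs : V2 := P x with hxs
  set xf : V2 := x - P x with hxf
  set ζs : V2 := P ζ with hζs
  set ζf : V2 := ζ - P ζ with hζf
  have hx : x = xs + xf := by rw [hxs, hxf]; abel
  have hζ : ζ = ζs + ζf := by rw [hζs, hζf]; abel
  have slow_of : ∀ y : V2, IsSlow n (P y) := fun y k' hk' => hPoff y k' hk'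
  have fast_of : ∀ y : V2, IsFast n (y - P y) := fun y k' hk' => by
    rw [fc_sub, hPon y k' hk', sub_self]
  have hxs_s : IsSlow n xs := slow_of x
  have hxf_f : IsFast n xf := fast_of x
  have hζs_s : IsSlow n ζs := slow_of ζ
  have hζf_f : IsFast n ζf := fast_of ζ
  -- slow and fast pieces are Fourier-disjoint
  have disj : ∀ {y y' : V2}, IsSlow n y → IsFast n y' → ∀ k', fc y k' = 0 ∨ fc y' k' = 0 := by
    intro y y' hy hy' k'
    by_cases hk' : k' ∈ Torus.freqBall (d := Fin 3) (n / 4)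
    · exact Or.inr (hy' k' hk')
    · exact Or.inl (hy k' hk')
  -- the coarse member: window of its tensor, support preservation (F0)
  have hn1 : (1:ℝ) ≤ n := by
    have h1 : (1:ℝ) ≤ ⌈K / ν⌉₊ := by
      have : 0 < K / ν := div_pos hK hν.1
      exact_mod_cast Nat.one_le_iff_ne_zero.2 (Nat.pos_iff_ne_zero.1 (Nat.ceil_pos.2 this))
    exact h1.trans hn
  have hn0 : (0:ℝ) < n := by linarith
  obtain ⟨lam, hlam, hA𝔸⟩ := hwin
  obtain ⟨lam', hlam', hΦn⟩ := hΦw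
  have hlam0 : 0 < lam := by linarith [hlam.1]
  have hlam'0 : 0 < lam' := by linarith [hlam'.1]
  have hcν : 0 ≤ c / ν := div_nonneg hc.le hν.1.le
  have hcoarse : Torus.NearIso ((1 / (n:ℝ) ^ 2) • (𝔸 + (c / ν) • Φ ν ((1 / ν) • 𝔸)))
      ((1 / (n:ℝ) ^ 2) * (ν * (lo / lam) + (c / ν) * (lo / lam'))) ((1 / (n:ℝ) ^ 2) * (ν * (hi * lam) + (c / ν) * (hi * lam'))) :=
    (hA𝔸.add (hΦn.smul hcν)).smul (by positivity)
  have hlo' : 0 < (1 / (n:ℝ) ^ 2) * (ν * (lo / lam) + (c / ν) * (lo / lam')) := by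
    have h1 : 0 < ν * (lo / lam) := mul_pos hν.1 (div_pos hlo hlam0)
    have h2 : 0 ≤ (c / ν) * (lo / lam') := mul_nonneg hcν (div_pos hlo hlam'0).le
    have h3 : 0 < 1 / (n:ℝ) ^ 2 := by positivity
    exact mul_pos h3 (by linarith)
  have hsupp := hF0 Tw _ _ _ hlo' hcoarse T hT s t hs hst.le htT
  -- orthogonality of the split, before and after `T s t` / its adjoint
  have hTs_slow : IsSlow n (T s t xs) := fun k' hk' => (hsupp xs k' (hxs_s k' hk')).1
  have hTf_fast : IsFast n (T s t xf) := fun k' hk' => (hsupp xf k' (hxf_f k' hk')).1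
  have hAs_slow : IsSlow n (ContinuousLinearMap.adjoint (T s t) ζs) := fun k' hk' => (hsupp ζs k' (hζs_s k' hk')).2
  have hAf_fast : IsFast n (ContinuousLinearMap.adjoint (T s t) ζf) := fun k' hk' => (hsupp ζf k' (hζf_f k' hk')).2
  have hox : ⟪xs, xf⟫_ℝ = 0 := inner_eq_zero_of_fc_disjoint (disj hxs_s hxf_f)
  have hoTx : ⟪T s t xs, T s t xf⟫_ℝ = 0 := inner_eq_zero_of_fc_disjoint (disj hTs_slow hTf_fast)
  have hoζ : ⟪ζs, ζf⟫_ℝ = 0 := inner_eq_zero_of_fc_disjoint (disj hζs_s hζf_f)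
  have hoAζ : ⟪ContinuousLinearMap.adjoint (T s t) ζs, ContinuousLinearMap.adjoint (T s t) ζf⟫_ℝ = 0 :=
    inner_eq_zero_of_fc_disjoint (disj hAs_slow hAf_fast)
  -- additivity of the two losses over the split
  have hTc : ∀ y, ‖T s t y‖ ≤ ‖y‖ := hT.norm_le s t
  have hq_add : lossFwd (T s t) x = lossFwd (T s t) xs + lossFwd (T s t) xf := by
    unfold lossFwd; rw [hx]; exact loss_add_of_orthogonal hox hoTx
  have hqs_add : lossAdj (T s t) ζ = lossAdj (T s t) ζs + lossAdj (T s t) ζf := by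
    unfold lossAdj; rw [hζ]; exact loss_add_of_orthogonal hoζ hoAζ
  have hq0 : ∀ y, 0 ≤ lossFwd (T s t) y := fun y => loss_nonneg hTc y
  have hqs0 : ∀ y, 0 ≤ lossAdj (T s t) y := fun y => lossAdj_nonneg hTc y
  -- the four block bounds at the pieces
  have hwin' : ∃ lam ∈ Set.Icc (1:ℝ) Λ, Torus.NearIso 𝔸 (ν * (lo / lam)) (ν * (hi * lam)) := ⟨lam, hlam, hA𝔸⟩
  have hΦw' : ∃ lam ∈ Set.Icc (1:ℝ) Λ, Torus.NearIso (Φ ν ((1 / ν) • 𝔸)) (lo / lam) (hi * lam) := ⟨lam', hlam', hΦn⟩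
  have b₁₁ := B₁ ν hν n hn 𝔸 hodd hwin' hΦo hΦw' Tw hTw U T hU hT s t hs hst htT xs ζs hxs_s hζs_s
  have b₁₂ := B₂ ν hν n hn 𝔸 hodd hwin' hΦo hΦw' Tw hTw U T hU hT s t hs hst htT xs ζf hxs_s hζf_f
  have b₂₁ := B₃ ν hν n hn 𝔸 hodd hwin' hΦo hΦw' Tw hTw U T hU hT s t hs hst htT xf ζs hxf_f hζs_s
  have b₂₂ := B₄ ν hν n hn 𝔸 hodd hwin' hΦo hΦw' Tw hTw U T hU hT s t hs hst htT xf ζf hxf_f hζf_f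
  -- common currency
  set a : ℝ := ν ^ σ' + ((⌈K / ν⌉₊ : ℝ) / n) ^ σ' with ha_def
  set m : ℝ := (min 1 ((M * W.period / ν) / (t - s))) ^ σ' with hm_def
  have ha0 : 0 ≤ a := by
    have h1 : 0 ≤ ν ^ σ' := Real.rpow_nonneg hν.1.le σ'
    have h2 : 0 ≤ ((⌈K / ν⌉₊ : ℝ) / n) ^ σ' := Real.rpow_nonneg (by positivity) σ'
    rw [ha_def]; linarith
  have hP0 : 0 ≤ (M * W.period / ν) / (t - s) :=
    div_nonneg (div_nonneg (mul_nonneg hM.le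
      (Summit.AnomalousDissipation.AnomalousDissipation.Theorems.SolenoidalFractalHomogenisation.PermissibleCarrier.period_pos W).le) hν.1.le)
      (by linarith)
  have hm0 : 0 ≤ m := by rw [hm_def]; exact Real.rpow_nonneg (le_min zero_le_one hP0) σ'
  have hη0 : ∀ {Cb : ℝ}, 0 ≤ Cb → 0 ≤ Cb * (Cb * a + m) := fun hCb => mul_nonneg hCb (by positivity)
  -- bilinear expansion and the 2×2 bookkeeping
  have hlin : U s t x - T s t x = (U s t xs - T s t xs) + (U s t xf - T s t xf) := by
    rw [hx, map_add, map_add]; abel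
  have key := lossBound_add_blocks (v₁ := U s t xs - T s t xs) (v₂ := U s t xf - T s t xf) (ζ₁ := ζs) (ζ₂ := ζf)
    (A := Real.sqrt (lossFwd (T s t) x)) (B := Real.sqrt (lossAdj (T s t) ζ))
    b₁₁ b₁₂ b₂₁ b₂₂ (hη0 hC₁) (hη0 hC₂) (hη0 hC₃) (hη0 hC₄)
    (Real.sqrt_nonneg _) (Real.sqrt_nonneg _) (Real.sqrt_nonneg _) (Real.sqrt_nonneg _)
    (by rw [Real.sq_sqrt (hq0 xs), Real.sq_sqrt (hq0 xf), Real.sq_sqrt (hq0 x), hq_add])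
    (by rw [Real.sq_sqrt (hqs0 ζs), Real.sq_sqrt (hqs0 ζf), Real.sq_sqrt (hqs0 ζ), hqs_add])
  rw [hlin, hζ]
  refine key.trans ?_
  have hsum := eta_sum_le (m := m) hC₁ hC₂ hC₃ hC₄ ha0
  have hAB : 0 ≤ Real.sqrt (lossFwd (T s t) x) * Real.sqrt (lossAdj (T s t) (ζs + ζf)) := by positivity
  rw [← hζ]
  calc (C₁ * (C₁ * a + m) + C₂ * (C₂ * a + m) + C₃ * (C₃ * a + m) + C₄ * (C₄ * a + m))
        * Real.sqrt (lossFwd (T s t) x) * Real.sqrt (lossAdj (T s t) ζ)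
      = (C₁ * (C₁ * a + m) + C₂ * (C₂ * a + m) + C₃ * (C₃ * a + m) + C₄ * (C₄ * a + m))
        * (Real.sqrt (lossFwd (T s t) x) * Real.sqrt (lossAdj (T s t) ζ)) := by ring
    _ ≤ ((C₁ + C₂ + C₃ + C₄) * ((C₁ + C₂ + C₃ + C₄) * a + m))
        * (Real.sqrt (lossFwd (T s t) x) * Real.sqrt (lossAdj (T s t) ζ)) :=
          mul_le_mul_of_nonneg_right hsum (by positivity)
    _ = ((C₁ + C₂ + C₃ + C₄) * ((C₁ + C₂ + C₃ + C₄) * a + m))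
        * Real.sqrt (lossFwd (T s t) x) * Real.sqrt (lossAdj (T s t) ζ) := by ring

/-! ## §3 The EVH assembly and the E ⇒ EVH/EH bridges (three-line corollaries of the pointwise reductions; the EH twins `bssNZ_of_ssModeH`,
`bss_of_bssNZH`, `bss_of_ssModeH`, `lossFlatW_of_blocksEH` are lead g6's `…VmodSSReduceH` / `…VmodFlatBlocksEH`) -/

/-- **ASSEMBLY EVH** (RULING D27-12): (F0), (ss)H and the three EVH blocks give the flat-stage target with the binder, `Cm = C₁ + C₂ + C₃ + C₄`
(`hC hV hH` passed to all four blocks). -/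
theorem lossFlatW_of_blocksEVH (e : ℝ → ℝ) (hF0 : CoarseSupp_text) (hss : Bss_textEH e) (hsf : Bsf_textEVH e) (hfs : Bfs_textEVH e)
    (hff : Bff_textEVH e) : lossFlatW_of_V_textEH e := by
  intro k W M hM c hc Φ lo hi Λ β σ C ν₀ K hlo hlo1 hhi hΛ hβ hσ hC hν₀ hν₀1 hK hV hH
  obtain ⟨C₁, hCC₁, B₁⟩ := hss k W M hM c hc Φ lo hi Λ β σ C ν₀ K hlo hlo1 hhi hΛ hβ hσ hC hν₀ hν₀1 hK hV hH
  obtain ⟨C₂, hC₂, B₂⟩ := hsf k W M hM c hc Φ lo hi Λ β σ C ν₀ K hlo hlo1 hhi hΛ hβ hσ hC hν₀ hν₀1 hK hV hH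
  obtain ⟨C₃, hC₃, B₃⟩ := hfs k W M hM c hc Φ lo hi Λ β σ C ν₀ K hlo hlo1 hhi hΛ hβ hσ hC hν₀ hν₀1 hK hV hH
  obtain ⟨C₄, hC₄, B₄⟩ := hff k W M hM c hc Φ lo hi Λ β σ C ν₀ K hlo hlo1 hhi hΛ hβ hσ hC hν₀ hν₀1 hK hV hH
  exact ⟨C₁ + C₂ + C₃ + C₄, by linarith, lossFlatW_of_blockBounds_at hF0 W M hM hc Φ hlo hK (hC.trans hCC₁) hC₂ hC₃ hC₄ B₁ B₂ B₃ B₄⟩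

/-- Bridge (E ⇒ EVH, binders ignored): `Bsf_textE e → Bsf_textEVH e`. -/
theorem bsfEVH_of_bsfE (e : ℝ → ℝ) (h : Bsf_textE e) : Bsf_textEVH e :=
  fun k W M hM c hc Φ lo hi Λ β σ _ ν₀ K hlo hlo1 hhi hΛ hβ hσ _ hν₀ hν₀1 hK _ _ =>
    h k W M hM c hc Φ lo hi Λ β σ ν₀ K hlo hlo1 hhi hΛ hβ hσ hν₀ hν₀1 hK

/-- Bridge (E ⇒ EVH): `Bfs_textE e → Bfs_textEVH e`. -/
theorem bfsEVH_of_bfsE (e : ℝ → ℝ) (h : Bfs_textE e) : Bfs_textEVH e :=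
  fun k W M hM c hc Φ lo hi Λ β σ _ ν₀ K hlo hlo1 hhi hΛ hβ hσ _ hν₀ hν₀1 hK _ _ =>
    h k W M hM c hc Φ lo hi Λ β σ ν₀ K hlo hlo1 hhi hΛ hβ hσ hν₀ hν₀1 hK

/-- Bridge (E ⇒ EVH): `Bff_textE e → Bff_textEVH e`. -/
theorem bffEVH_of_bffE (e : ℝ → ℝ) (h : Bff_textE e) : Bff_textEVH e :=
  fun k W M hM c hc Φ lo hi Λ β σ _ ν₀ K hlo hlo1 hhi hΛ hβ hσ _ hν₀ hν₀1 hK _ _ =>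
    h k W M hM c hc Φ lo hi Λ β σ ν₀ K hlo hlo1 hhi hΛ hβ hσ hν₀ hν₀1 hK

/-- Bridge (E ⇒ EH): `Bss_textE e → Bss_textEH e` (so `Bss_textEH` is also the «EVH» text of the (ss) block — it already carries `C`, (V)). -/
theorem bssEH_of_bssE (e : ℝ → ℝ) (h : Bss_textE e) : Bss_textEH e :=
  fun k W M hM c hc Φ lo hi Λ β σ C ν₀ K hlo hlo1 hhi hΛ hβ hσ hC hν₀ hν₀1 hK hV _ =>
    h k W M hM c hc Φ lo hi Λ β σ C ν₀ K hlo hlo1 hhi hΛ hβ hσ hC hν₀ hν₀1 hK hV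

/-- Bridge (E ⇒ EH, binder ignored): `SSMode_textE e → SSMode_textEH e`. -/
theorem ssModeEH_of_ssModeE (e : ℝ → ℝ) (h : SSMode_textE e) : SSMode_textEH e :=
  fun k W M hM c hc Φ lo hi Λ β σ C ν₀ K hlo hlo1 hhi hΛ hβ hσ hC hν₀ hν₀1 hK hV _ =>
    h k W M hM c hc Φ lo hi Λ β σ C ν₀ K hlo hlo1 hhi hΛ hβ hσ hC hν₀ hν₀1 hK hV

/-- Bridge (E ⇒ EH): `lossFlatW_of_V_textE e → lossFlatW_of_V_textEH e`. -/
theorem lossFlatWEH_of_lossFlatWE (e : ℝ → ℝ) (h : lossFlatW_of_V_textE e) : lossFlatW_of_V_textEH e :=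
  fun k W M hM c hc Φ lo hi Λ β σ C ν₀ K hlo hlo1 hhi hΛ hβ hσ hC hν₀ hν₀1 hK hV _ =>
    h k W M hM c hc Φ lo hi Λ β σ C ν₀ K hlo hlo1 hhi hΛ hβ hσ hC hν₀ hν₀1 hK hV

end Summit.AnomalousDissipation.AnomalousDissipation.Theorems.SolenoidalFractalHomogenisation.LagrangianStep.VmodFlat

end
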